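import Mathlib.Topology.Algebra.ClopenNhdofOne
import Literature.IUT.HodgeTheaters.TemperedCoveringsCor23viOfPSCAbutmentOfCuspEdgeDict
import HarnessLib

/-!
# [IUTchI] Cor. 2.3 (vi): the pro-`Σ̂` incidence `hF` is EQUIVALENT to a TEMPERED-LEVEL (finite-quotient) conjugacy
# separation — the «sufficient, not necessary» caveat of the separating-quotient criterion removed (proof-only)

S. Mochizuki, *Inter-universal Teichmüller theory I*, kurims manuscript (May 2020), §2, Cor. 2.3 (vi) p. 48 l. 6–16, proof
p. 49 l. 62–64 («by passing to pro-`Σ` completions») [cite: Mochizuki2012, Cor 2.3(vi) pp.48-49] (D-0012 claim key; series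
status DISPUTED; nothing of the series is asserted here); S. Mochizuki, *Semi-graphs of anabelioids*, Publ. RIMS **42**
(2006), §3 Prop. 3.6 (iii) p. 38 (the natural injection `π₁^temp(𝒢) ↪ π₁^temp(𝒢)^∧` into the profinite completion), §6
p. 69 [cite: MochizukiSemiAnbd2006, Prop 3.6(iii) p.38].

PROOF-ONLY file (abc-iut cell, seat abc-iut-w4-d070 gen 13; self-announced count-neutral in-lineage sequel
«COR23VI-HF-IFF-CONJSEP» of this lineage's p498282 `TemperedCoveringsCor23viHatIncidenceOfSeparatingQuotient.lean`, in
support of L5 ROWS #7 row R58 (holder abc-iut-L5-d5); cone row `IUTchI:Cor2.3(vi)` (discharged, RULINGS #118, residual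
`hF` = GAP-LEDGER G-w4d059-g8-1); no definition, no instance, no new `Prop` fact).

THE POINT.  p498282 proved `hF` ⟸ «some finite quotient of `Π^tp_𝔾` KILLS `Π^tp_ℍ` but not the edge-like `L`» and
recorded that this is SUFFICIENT, NOT NECESSARY.  This file gives the EXACT tempered-level content of `hF`.  For ANY
`IsProfiniteCompletion ι : Π →ₜ* Π̂` (abc-iut-L3: `Π̂` profinite, `ι` dense, open normal finite-index subgroups of `Π` =
inverse images of open normal subgroups of `Π̂`) and ANY subgroups `T, L ≤ Π` (§1):
`forall_not_map_le_conj_closure_iff_exists_openNormal` — **«`ι(L)` lies in NO `Π̂`-conjugate of the closure of `ι(T)`» ⟺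
«some open normal finite-index `U ⊴ Π` has `L ≰ (t T t⁻¹)·U` for EVERY `t ∈ Π`»** (in the finite quotient `Π/U` the
image of `L` lies in no conjugate of the image of `T`).  «⟸» (`not_map_le_conj_closure_of_forall_not_le_conj_sup`):
density of `ι` replaces `g ∈ Π̂` by some `ι(t) ∈ gV`, and the closure of `ι(T)` lies in the open subgroup `ι(T)·V`,
`U = ι⁻¹V`.  «⟹» (`exists_openNormal_forall_not_le_conj_sup_of_forall_not_map_le_conj_closure`): compactness of `Π̂` —
the sets `S_V = {g | ι(L) ≤ g (ι(T)·V) g⁻¹}`, `V ⊴ Π̂` open normal, are closed and directed, so if all were non-empty a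
point of `⋂_V S_V` would conjugate `ι(L)` into `⋂_V A·V = A` (§0); NO finite generation of `L` is needed.  p498282's
separating quotient is the special case `T ≤ U` (`forall_not_le_conj_sup_of_le_of_not_le`).

Hence (§2), at ANY chart and ANY profinite completion, **`hF` ⟺ `hconj`** (`hatEdgeIncidence_iff_conjSeparating`,
open-edge twin `hatCuspIncidence_iff_conjSeparating`): «every edge-like `L` of an edge no branch of which abuts a vertex
of `ℍ` is CONJUGACY-SEPARATED from `Π^tp_ℍ` in some FINITE quotient of `Π^tp_𝔾`».  READING (docstring only, not a
kernel claim; finite quotients of `π₁^temp(𝒢)` = Galois groups of finite étale Galois coverings, [SemiAnbd] §3): for `ℍ`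
connected and `Π^tp_ℍ`, `L` decomposition groups, «for every edge `e` not abutting `ℍ` some finite étale Galois covering
`𝒢' → 𝒢` has an edge over `e` whose decomposition group stabilises NO connected component of `𝒢' ×_𝒢 ℍ`» — the
profinite Bass–Serre content of print's «by passing to pro-`Σ` completions» isolated in finite-level currency.  At
p498282's caveat configuration (genus-`0` vertex `v ∉ ℍ` whose other two edges run into `ℍ`, `e⁻¹ = n₁n₂`) no quotient
KILLING `Π^tp_ℍ` separates `⟨e⟩`; a conjugacy-separating quotient there must be non-trivial on `Π^tp_ℍ` (e.g. onto
`𝔖₃` with `Π^tp_ℍ ↦ ⟨(12)⟩`, `n₁ ↦ (12)`, `n₂ ↦ (23)`, `e⁻¹ ↦ (123)`, WHEN the data admit such a quotient —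
illustration only, neither formalised nor claimed in general).

§3 records the row-`IUTchI:Cor2.3(vi)` consumers over abc-iut-L3's origin record `PiData` with p498282's separation
hypothesis WEAKENED to `hconj` (knit with abc-iut-L5-d5's `P.CuspOpenEdgeDict` exactly as there), and the iff for the
record's own binder `hF` at the datum's completion (`hatEdgeIncidence_piData_iff_conjSeparating`).  So G-w4d059-g8-1 is
NOT discharged here; it is shown EQUIVALENT to a residual property of the tempered group.  Model-RELATIVE at the genuine
datum; typed ≠ discharged for the [IUTchI] claim keys; nothing here bears on [IUTchIII] Cor. 3.12 or asserts that abc is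
proved or refuted.
-/

noncomputable section

namespace Literature.IUT.HodgeTheaters

open _root_.Topology
open scoped Pointwise
open Literature.AnabelianGeometry.SemiGraphs
open Literature.AnabelianGeometry.SemiGraphs.ProfiniteSemiGraph

universe u v w

namespace StableCurveTemperedData

/-! ### 0. A closed subgroup of a profinite group is the intersection of its open-normal thickenings -/

/-- In a profinite group, an element lying in `H·V` for EVERY open normal subgroup `V` lies in the closure of `H` (the
open normal subgroups form a neighbourhood basis of `1`, Mathlib's `ProfiniteGrp.exist_openNormalSubgroup_sub_open_nhds_of_one`).
[cite: MochizukiSemiAnbd2006, §6 p.69] -/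
theorem mem_topologicalClosure_of_forall_mem_sup_openNormal {K : Type w} [Group K] [TopologicalSpace K]
    [IsTopologicalGroup K] [CompactSpace K] [TotallyDisconnectedSpace K] (H : Subgroup K) {y : K}
    (hy : ∀ V : OpenNormalSubgroup K, y ∈ H ⊔ V.toSubgroup) : y ∈ H.topologicalClosure := by
  change y ∈ closure (H : Set K)
  rw [mem_closure_iff]
  intro O hO hyO
  have hW : IsOpen ((fun k : K => y * k) ⁻¹' O) := hO.preimage (continuous_const.mul continuous_id)
  obtain ⟨V, hV⟩ := ProfiniteGrp.exist_openNormalSubgroup_sub_open_nhds_of_one hW (by simpa using hyO)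
  obtain ⟨a, ha, b, hb, hab⟩ := Subgroup.mem_sup_of_normal_right.mp (hy V)
  refine ⟨a, ?_, ha⟩
  have hb' : y * b⁻¹ ∈ O := hV (V.toSubgroup.inv_mem hb)
  rwa [← hab, mul_inv_cancel_right] at hb'

/-! ### 1. Conjugacy separation: profinite completion versus finite quotients -/

section Algebra

variable {G : Type u} [Group G] (T : Subgroup G)

/-- Bookkeeping: `x ∈ (t T t⁻¹)·U` from a factorisation `x = t s t⁻¹ u`, `s ∈ T`, `u ∈ U`.
[cite: MochizukiSemiAnbd2006, Prop 3.6(iii) p.38] -/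
theorem mem_conj_sup_of_eq (U : Subgroup G) {x t s u : G} (hs : s ∈ T) (hu : u ∈ U)
    (hx : x = t * s * t⁻¹ * u) : x ∈ MulAut.conj t • T ⊔ U := by
  rw [hx]
  exact Subgroup.mul_mem _ (Subgroup.mem_sup_left ((Subgroup.mem_smul_pointwise_iff_exists _ _ _).mpr
    ⟨s, hs, by simp [MulAut.smul_def, MulAut.conj_apply]⟩)) (Subgroup.mem_sup_right hu)

/-- Bookkeeping: membership in `(t T t⁻¹)·U`, `U` normal, yields a factorisation `x = t s t⁻¹ u`.
[cite: MochizukiSemiAnbd2006, Prop 3.6(iii) p.38] -/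
theorem exists_eq_of_mem_conj_sup (U : Subgroup G) [U.Normal] {x t : G} (hx : x ∈ MulAut.conj t • T ⊔ U) :
    ∃ s ∈ T, ∃ u ∈ U, x = t * s * t⁻¹ * u := by
  obtain ⟨a, ha, u, hu, hau⟩ := Subgroup.mem_sup_of_normal_right.mp hx
  obtain ⟨s, hs, hsa⟩ := (Subgroup.mem_smul_pointwise_iff_exists _ _ _).mp ha
  exact ⟨s, hs, u, hu, by rw [← hau, ← hsa, MulAut.smul_def, MulAut.conj_apply]⟩

/-- p498282's separating quotient is the special case `T ≤ U`: a quotient killing `T` but not `L` conjugacy-separates.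
[cite: MochizukiSemiAnbd2006, Prop 3.6(iii) p.38] -/
theorem forall_not_le_conj_sup_of_le_of_not_le (L U : Subgroup G) [U.Normal] (hT : T ≤ U) (hL : ¬ L ≤ U) :
    ∀ t : G, ¬ L ≤ MulAut.conj t • T ⊔ U := fun t h =>
  hL (h.trans (sup_le ((Subgroup.pointwise_smul_le_pointwise_smul_iff.mpr hT).trans
    (Subgroup.Normal.conj_smul_eq_self t U).le) le_rfl))

end Algebra

section Completion

variable {G : Type u} [Group G] [TopologicalSpace G]
  {Ghat : Type v} [Group Ghat] [TopologicalSpace Ghat] [IsTopologicalGroup Ghat]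
  {ι : G →ₜ* Ghat} (hι : IsProfiniteCompletion ι) (T L : Subgroup G)

include hι in
/-- **FINITE ⇒ PROFINITE conjugacy separation.**  If some open normal finite-index `U ⊴ Π` has `L ≰ (t T t⁻¹)·U` for every
`t ∈ Π` (the image of `L` in `Π/U` lies in no conjugate of the image of `T`), then `ι(L)` lies in NO `Π̂`-conjugate of
the closure of `ι(T)`. [cite: MochizukiSemiAnbd2006, Prop 3.6(iii) p.38] -/
theorem not_map_le_conj_closure_of_forall_not_le_conj_sup (U : OpenNormalSubgroup G) (hU : U.toSubgroup.FiniteIndex)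
    (hsep : ∀ t : G, ¬ L ≤ MulAut.conj t • T ⊔ U.toSubgroup) (g : Ghat) :
    ¬ L.map ι.toMonoidHom ≤ MulAut.conj g • (T.map ι.toMonoidHom).topologicalClosure := by
  intro h
  obtain ⟨V, hUV⟩ := hι.comap_surjective U hU
  -- density: some `ι t` lies in the open coset `g • V`
  have hcos : IsOpen (g • (V : Set Ghat)) := V.isOpen'.smul g
  obtain ⟨t, ht⟩ := hι.denseRange.exists_mem_open hcos
    ⟨g, Set.mem_smul_set.mpr ⟨1, one_mem V, by rw [smul_eq_mul, mul_one]⟩⟩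
  have ht' : ι.toMonoidHom t ∈ g • (V : Set Ghat) := ht
  obtain ⟨v, hv, hgv⟩ := Set.mem_smul_set.mp ht'
  have hg : g = ι.toMonoidHom t * v⁻¹ := by rw [← hgv, smul_eq_mul, mul_inv_cancel_right]
  -- the open subgroup `ι(T)·V` contains the closure of `ι(T)`
  have hWo : IsOpen ((T.map ι.toMonoidHom ⊔ V.toSubgroup : Subgroup Ghat) : Set Ghat) :=
    Subgroup.isOpen_mono (le_sup_right : V.toSubgroup ≤ _) V.isOpen'
  have hAW : (T.map ι.toMonoidHom).topologicalClosure ≤ T.map ι.toMonoidHom ⊔ V.toSubgroup :=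
    Subgroup.topologicalClosure_minimal _ le_sup_left (Subgroup.isClosed_of_isOpen _ hWo)
  apply hsep t
  intro x hx
  have h1 : ι.toMonoidHom x ∈ MulAut.conj g • (T.map ι.toMonoidHom).topologicalClosure := h ⟨x, hx, rfl⟩
  rw [Subgroup.mem_pointwise_smul_iff_inv_smul_mem, MulAut.smul_def, MulAut.conj_inv_apply] at h1
  obtain ⟨a, ha, w, hw, haw⟩ := Subgroup.mem_sup_of_normal_right.mp (hAW h1)
  obtain ⟨s, hs, rfl⟩ := ha
  rw [hg] at haw
  have e1 : (ι.toMonoidHom t)⁻¹ * ι.toMonoidHom x * ι.toMonoidHom t = v⁻¹ * (ι.toMonoidHom s * w) * v := by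
    rw [haw]; group
  -- `u := s⁻¹ t⁻¹ x t ∈ U = ι⁻¹ V`
  have hu : s⁻¹ * (t⁻¹ * x * t) ∈ U.toSubgroup := by
    rw [hUV, Subgroup.mem_comap]
    have e2 : ι.toMonoidHom (s⁻¹ * (t⁻¹ * x * t)) = ((ι.toMonoidHom s)⁻¹ * v⁻¹ * ι.toMonoidHom s) * (w * v) := by
      rw [map_mul, map_inv, map_mul, map_mul, map_inv, e1]; group
    rw [e2]
    exact V.toSubgroup.mul_mem (V.isNormal'.conj_mem' _ (V.toSubgroup.inv_mem hv) _) (V.toSubgroup.mul_mem hw hv)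
  refine mem_conj_sup_of_eq T U.toSubgroup (t := t) (s := s) (u := t * (s⁻¹ * (t⁻¹ * x * t)) * t⁻¹) hs
    (U.isNormal'.conj_mem _ hu t) ?_
  group

include hι in
/-- **PROFINITE ⇒ FINITE conjugacy separation** (compactness of `Π̂`; no finite generation of `L` needed).  If `ι(L)` lies in
no `Π̂`-conjugate of the closure of `ι(T)`, then some open normal finite-index `U ⊴ Π` has `L ≰ (t T t⁻¹)·U` for every
`t ∈ Π`. [cite: MochizukiSemiAnbd2006, Prop 3.6(iii) p.38] -/
theorem exists_openNormal_forall_not_le_conj_sup_of_forall_not_map_le_conj_closure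
    (h : ∀ g : Ghat, ¬ L.map ι.toMonoidHom ≤ MulAut.conj g • (T.map ι.toMonoidHom).topologicalClosure) :
    ∃ U : OpenNormalSubgroup G, U.toSubgroup.FiniteIndex ∧ ∀ t : G, ¬ L ≤ MulAut.conj t • T ⊔ U.toSubgroup := by
  haveI := hι.compactSpace
  haveI := hι.t2Space
  haveI := hι.totallyDisconnectedSpace
  -- Step 1: an open normal `V ⊴ Π̂` such that `ι(L)` lies in no conjugate of `ι(T)·V`.
  have key : ∃ V : OpenNormalSubgroup Ghat, ∀ g : Ghat,
      ¬ L.map ι.toMonoidHom ≤ MulAut.conj g • (T.map ι.toMonoidHom ⊔ V.toSubgroup) := by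
    by_contra hcon
    push Not at hcon
    let S : OpenNormalSubgroup Ghat → Set Ghat := fun V =>
      {g | ∀ x ∈ L, g⁻¹ * ι.toMonoidHom x * g ∈ T.map ι.toMonoidHom ⊔ V.toSubgroup}
    have hSof : ∀ (V : OpenNormalSubgroup Ghat) (g : Ghat),
        L.map ι.toMonoidHom ≤ MulAut.conj g • (T.map ι.toMonoidHom ⊔ V.toSubgroup) → g ∈ S V := by
      intro V g hg x hx
      have := hg ⟨x, hx, rfl⟩
      rwa [Subgroup.mem_pointwise_smul_iff_inv_smul_mem, MulAut.smul_def, MulAut.conj_inv_apply] at this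
    have hSclosed : ∀ V, IsClosed (S V) := by
      intro V
      have hWo : IsOpen ((T.map ι.toMonoidHom ⊔ V.toSubgroup : Subgroup Ghat) : Set Ghat) :=
        Subgroup.isOpen_mono (le_sup_right : V.toSubgroup ≤ _) V.isOpen'
      have hWc : IsClosed ((T.map ι.toMonoidHom ⊔ V.toSubgroup : Subgroup Ghat) : Set Ghat) :=
        Subgroup.isClosed_of_isOpen _ hWo
      have : S V = ⋂ x ∈ L, (fun g : Ghat => g⁻¹ * ι.toMonoidHom x * g) ⁻¹'
          ((T.map ι.toMonoidHom ⊔ V.toSubgroup : Subgroup Ghat) : Set Ghat) := by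
        ext g; simp [S]
      rw [this]
      exact isClosed_biInter fun x _ =>
        hWc.preimage ((continuous_inv.mul continuous_const).mul continuous_id)
    have hSne : ∀ V, (S V).Nonempty := fun V => (hcon V).imp (hSof V)
    have hSdir : Directed (· ⊇ ·) S := by
      have hmono : ∀ V₁ V₂ : OpenNormalSubgroup Ghat, V₁.toSubgroup ≤ V₂.toSubgroup → S V₁ ⊆ S V₂ :=
        fun V₁ V₂ hle g hg x hx => sup_le_sup_left hle _ (hg x hx)
      intro V₁ V₂
      have h12 : (V₁ ⊓ V₂ : OpenNormalSubgroup Ghat).toSubgroup = V₁.toSubgroup ⊓ V₂.toSubgroup := rfl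
      exact ⟨V₁ ⊓ V₂, hmono _ _ (h12 ▸ inf_le_left), hmono _ _ (h12 ▸ inf_le_right)⟩
    haveI : Nonempty (OpenNormalSubgroup Ghat) :=
      ⟨{ toOpenSubgroup := ⊤, isNormal' := by change (⊤ : Subgroup Ghat).Normal; infer_instance }⟩
    obtain ⟨g, hg⟩ := IsCompact.nonempty_iInter_of_directed_nonempty_isCompact_isClosed S hSdir hSne
      (fun V => (hSclosed V).isCompact) hSclosed
    apply h g
    rintro _ ⟨x, hx, rfl⟩
    rw [Subgroup.mem_pointwise_smul_iff_inv_smul_mem, MulAut.smul_def, MulAut.conj_inv_apply]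
    exact mem_topologicalClosure_of_forall_mem_sup_openNormal _ fun V => (Set.mem_iInter.mp hg V) x hx
  -- Step 2: pull `V` back to `Π`.
  obtain ⟨V, hV⟩ := key
  let U : OpenNormalSubgroup G :=
    { toSubgroup := V.toSubgroup.comap ι.toMonoidHom
      isOpen' := hι.isOpen_comap V
      isNormal' := Subgroup.Normal.comap V.isNormal' _ }
  refine ⟨U, ?_, fun t hLt => hV (ι.toMonoidHom t) ?_⟩
  · haveI : Finite (Ghat ⧸ V.toSubgroup) := Subgroup.quotient_finite_of_isOpen _ V.isOpen'
    have hVi : V.toSubgroup.index ≠ 0 := (Subgroup.finiteIndex_of_finite_quotient (H := V.toSubgroup)).index_ne_zero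
    refine ⟨?_⟩
    change (V.toSubgroup.comap ι.toMonoidHom).index ≠ 0
    rw [Subgroup.index_comap]
    exact ne_zero_of_dvd_ne_zero hVi (Subgroup.relIndex_dvd_index_of_normal _ _)
  · rintro _ ⟨x, hx, rfl⟩
    obtain ⟨s, hs, u, hu, hxe⟩ := exists_eq_of_mem_conj_sup T U.toSubgroup (hLt hx)
    have hu' : ι.toMonoidHom u ∈ V.toSubgroup := hu
    rw [Subgroup.mem_pointwise_smul_iff_inv_smul_mem, MulAut.smul_def, MulAut.conj_inv_apply, hxe]
    have e : (ι.toMonoidHom t)⁻¹ * ι.toMonoidHom (t * s * t⁻¹ * u) * ι.toMonoidHom t =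
        ι.toMonoidHom s * ((ι.toMonoidHom t)⁻¹ * ι.toMonoidHom u * ι.toMonoidHom t) := by
      rw [map_mul, map_mul, map_mul, map_inv]; group
    rw [e]
    exact Subgroup.mul_mem _ (Subgroup.mem_sup_left ⟨s, hs, rfl⟩)
      (Subgroup.mem_sup_right (V.isNormal'.conj_mem' _ hu' _))

include hι in
/-- **The IFF**: `ι(L)` lies in no `Π̂`-conjugate of the closure of `ι(T)` iff `L` is conjugacy-separated from `T` in some
finite (discrete) quotient of `Π`. [cite: MochizukiSemiAnbd2006, Prop 3.6(iii) p.38] -/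
theorem forall_not_map_le_conj_closure_iff_exists_openNormal :
    (∀ g : Ghat, ¬ L.map ι.toMonoidHom ≤ MulAut.conj g • (T.map ι.toMonoidHom).topologicalClosure) ↔
      ∃ U : OpenNormalSubgroup G, U.toSubgroup.FiniteIndex ∧ ∀ t : G, ¬ L ≤ MulAut.conj t • T ⊔ U.toSubgroup :=
  ⟨exists_openNormal_forall_not_le_conj_sup_of_forall_not_map_le_conj_closure hι T L,
    fun ⟨U, hU, hsep⟩ => not_map_le_conj_closure_of_forall_not_le_conj_sup hι T L U hU hsep⟩

end Completion

/-! ### 2. `hF` ⟺ conjugacy separation, at any chart and any profinite completion -/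

section Chart

variable {𝒢 : ProfiniteSemiGraph.{u}} (c : TemperedPiChart 𝒢) {Ghat : Type v} [Group Ghat] [TopologicalSpace Ghat]
  [IsTopologicalGroup Ghat] {ι : c.G →ₜ* Ghat} (hι : IsProfiniteCompletion ι)
  (H : 𝒢.graph.Subgraph) (TpH : Subgroup c.G)

include hι in
/-- **`hF` ⟸ CONJUGACY SEPARATION** (usable direction; hypothesis WEAKER than p498282's
`hatEdgeIncidence_of_openNormalSeparating`): if every edge-like `L` of an edge no branch of which abuts a vertex of `ℍ` is
conjugacy-separated from `Π^tp_ℍ := TpH` in some finite quotient of `Π^tp_𝔾`, then `hF` (G-w4d059-g8-1, abc-iut-w4-d059's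
shape) holds. [cite: MochizukiSemiAnbd2006, Prop 3.6(iii) p.38] -/
theorem hatEdgeIncidence_of_conjSeparating
    (hconj : ∀ e : 𝒢.graph.Edge,
      (¬ ∃ b : 𝒢.graph.Branch, 𝒢.graph.edgeOf b = e ∧ ∃ w ∈ H.verts, 𝒢.graph.abuts b = some w) →
      ∀ L ∈ edgeLikeSubgroups c e, ∃ U : OpenNormalSubgroup c.G,
        U.toSubgroup.FiniteIndex ∧ ∀ t : c.G, ¬ L ≤ MulAut.conj t • TpH ⊔ U.toSubgroup) :
    ∀ e : 𝒢.graph.Edge, ∀ L ∈ edgeLikeSubgroups c e, ∀ g : Ghat,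
      L.map ι.toMonoidHom ≤ MulAut.conj g • (TpH.map ι.toMonoidHom).topologicalClosure →
        ∃ b : 𝒢.graph.Branch, 𝒢.graph.edgeOf b = e ∧ ∃ w ∈ H.verts, 𝒢.graph.abuts b = some w := by
  intro e L hL g hg
  by_contra habut
  exact (hconj e habut L hL).elim fun U hU => not_map_le_conj_closure_of_forall_not_le_conj_sup hι TpH L U hU.1 hU.2 g hg

include hι in
/-- **`hF` ⟺ CONJUGACY SEPARATION** at any chart and any profinite completion: `hF` holds iff every edge-like subgroup of an
edge not abutting `ℍ` is conjugacy-separated from `Π^tp_ℍ` in some finite quotient of `Π^tp_𝔾`.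
[cite: MochizukiSemiAnbd2006, Prop 3.6(iii) p.38] -/
theorem hatEdgeIncidence_iff_conjSeparating :
    (∀ e : 𝒢.graph.Edge, ∀ L ∈ edgeLikeSubgroups c e, ∀ g : Ghat,
      L.map ι.toMonoidHom ≤ MulAut.conj g • (TpH.map ι.toMonoidHom).topologicalClosure →
        ∃ b : 𝒢.graph.Branch, 𝒢.graph.edgeOf b = e ∧ ∃ w ∈ H.verts, 𝒢.graph.abuts b = some w) ↔
    (∀ e : 𝒢.graph.Edge,
      (¬ ∃ b : 𝒢.graph.Branch, 𝒢.graph.edgeOf b = e ∧ ∃ w ∈ H.verts, 𝒢.graph.abuts b = some w) →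
      ∀ L ∈ edgeLikeSubgroups c e, ∃ U : OpenNormalSubgroup c.G,
        U.toSubgroup.FiniteIndex ∧ ∀ t : c.G, ¬ L ≤ MulAut.conj t • TpH ⊔ U.toSubgroup) := by
  refine ⟨fun hF e habut L hL => ?_, hatEdgeIncidence_of_conjSeparating c hι H TpH⟩
  exact exists_openNormal_forall_not_le_conj_sup_of_forall_not_map_le_conj_closure hι TpH L
    fun g hg => habut (hF e L hL g hg)

include hι in
/-- **Open-edge twin, usable direction** (for abc-iut-w4-d059's `hFcusp`): conjugacy separation is asked only of the
OPEN edges not abutting `ℍ`. [cite: MochizukiSemiAnbd2006, Prop 3.6(iii) p.38] -/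
theorem hatCuspIncidence_of_conjSeparating
    (hconj : ∀ e : 𝒢.graph.Edge, (∃ b₀ : 𝒢.graph.Branch, 𝒢.graph.edgeOf b₀ = e ∧ 𝒢.graph.abuts b₀ = none) →
      (¬ ∃ b : 𝒢.graph.Branch, 𝒢.graph.edgeOf b = e ∧ ∃ w ∈ H.verts, 𝒢.graph.abuts b = some w) →
      ∀ L ∈ edgeLikeSubgroups c e, ∃ U : OpenNormalSubgroup c.G,
        U.toSubgroup.FiniteIndex ∧ ∀ t : c.G, ¬ L ≤ MulAut.conj t • TpH ⊔ U.toSubgroup) :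
    ∀ e : 𝒢.graph.Edge, (∃ b₀ : 𝒢.graph.Branch, 𝒢.graph.edgeOf b₀ = e ∧ 𝒢.graph.abuts b₀ = none) →
      ∀ L ∈ edgeLikeSubgroups c e, ∀ g : Ghat,
        L.map ι.toMonoidHom ≤ MulAut.conj g • (TpH.map ι.toMonoidHom).topologicalClosure →
          ∃ b : 𝒢.graph.Branch, 𝒢.graph.edgeOf b = e ∧ ∃ w ∈ H.verts, 𝒢.graph.abuts b = some w := by
  intro e he L hL g hg
  by_contra habut
  exact (hconj e he habut L hL).elim fun U hU => not_map_le_conj_closure_of_forall_not_le_conj_sup hι TpH L U hU.1 hU.2 g hg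

include hι in
/-- **Open-edge twin of the iff.** [cite: MochizukiSemiAnbd2006, Prop 3.6(iii) p.38] -/
theorem hatCuspIncidence_iff_conjSeparating :
    (∀ e : 𝒢.graph.Edge, (∃ b₀ : 𝒢.graph.Branch, 𝒢.graph.edgeOf b₀ = e ∧ 𝒢.graph.abuts b₀ = none) →
      ∀ L ∈ edgeLikeSubgroups c e, ∀ g : Ghat,
        L.map ι.toMonoidHom ≤ MulAut.conj g • (TpH.map ι.toMonoidHom).topologicalClosure →
          ∃ b : 𝒢.graph.Branch, 𝒢.graph.edgeOf b = e ∧ ∃ w ∈ H.verts, 𝒢.graph.abuts b = some w) ↔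
    (∀ e : 𝒢.graph.Edge, (∃ b₀ : 𝒢.graph.Branch, 𝒢.graph.edgeOf b₀ = e ∧ 𝒢.graph.abuts b₀ = none) →
      (¬ ∃ b : 𝒢.graph.Branch, 𝒢.graph.edgeOf b = e ∧ ∃ w ∈ H.verts, 𝒢.graph.abuts b = some w) →
      ∀ L ∈ edgeLikeSubgroups c e, ∃ U : OpenNormalSubgroup c.G,
        U.toSubgroup.FiniteIndex ∧ ∀ t : c.G, ¬ L ≤ MulAut.conj t • TpH ⊔ U.toSubgroup) := by
  refine ⟨fun hF e he habut L hL => ?_, hatCuspIncidence_of_conjSeparating c hι H TpH⟩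
  exact exists_openNormal_forall_not_le_conj_sup_of_forall_not_map_le_conj_closure hι TpH L
    fun g hg => habut (hF e he L hL g hg)

end Chart

/-! ### 3. Row `IUTchI:Cor2.3(vi)` over abc-iut-L3's origin record, from CONJUGACY separation -/

section PiData

variable {p : ℕ} [Fact p.Prime] (X : TemperedCurve p) (d : X.GroupLevelData)
  (S : SpecialFibreData (X.toTemperedArithmeticGroup d)) (h36 : S.Gc.Prop36Hypotheses)
  (Sigma SigmaHat : Set ℕ) (hsub : Sigma ⊆ SigmaHat) (hne : Sigma.Nonempty)
  (hprime : ∀ q ∈ SigmaHat, q.Prime) (hp : p ∉ Sigma)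
  (TpH : Subgroup S.chart.G)
  {T : SpecialFibreTower X.DeltaTemp} (P : SpecialFibreTower.PiData X d S T)

/-- **The record's binder `hF` (abc-iut-w4-d059 / p492945 shape, at the datum's completion and the record's `Π^tp_ℍ := P.TpH`)
⟺ conjugacy separation of the non-abutting edge-like subgroups from `P.TpH` in finite quotients of `Π^tp_𝔾`** — the exact
tempered-level content of GAP-LEDGER G-w4d059-g8-1 at the origin record. [cite: Mochizuki2012, Cor 2.3(vi) pp.48-49]
[claim: Mochizuki2012, status: disputed] -/
theorem hatEdgeIncidence_piData_iff_conjSeparating :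
    (∀ (e : S.Gc.graph.Edge), ∀ L ∈ edgeLikeSubgroups S.chart e,
      ∀ g : (TemperedGraphGroupData.exists_completion_of_prop36 S.Gc h36 S.chart).choose,
        L.map (TemperedGraphGroupData.exists_completion_of_prop36 S.Gc h36 S.chart).choose_spec.choose.toMonoidHom ≤
          MulAut.conj g • (P.TpH.map (TemperedGraphGroupData.exists_completion_of_prop36 S.Gc h36
            S.chart).choose_spec.choose.toMonoidHom).topologicalClosure →
        ∃ b : S.Gc.graph.Branch, S.Gc.graph.edgeOf b = e ∧ ∃ w ∈ P.H.verts, S.Gc.graph.abuts b = some w) ↔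
    (∀ e : S.Gc.graph.Edge,
      (¬ ∃ b : S.Gc.graph.Branch, S.Gc.graph.edgeOf b = e ∧ ∃ w ∈ P.H.verts, S.Gc.graph.abuts b = some w) →
      ∀ L ∈ edgeLikeSubgroups S.chart e, ∃ U : OpenNormalSubgroup S.chart.G,
        U.toSubgroup.FiniteIndex ∧ ∀ t : S.chart.G, ¬ L ≤ MulAut.conj t • P.TpH ⊔ U.toSubgroup) :=
  hatEdgeIncidence_iff_conjSeparating S.chart
    (TemperedGraphGroupData.exists_completion_of_prop36 S.Gc h36 S.chart).choose_spec.choose_spec.1 P.H P.TpH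

/-- **Row `IUTchI:Cor2.3(vi)` over the origin record, PRINT'S record-vertex atom, any `Π^tp_ℍ := TpH ∈ decompSubgroups S.chart
P.H`** ⟸ {`hdict : P.CuspOpenEdgeDict` (ORIGIN record datum), `hconj` (CONJUGACY separation of the open edges not abutting
`ℍ` from `Π^tp_ℍ` in finite quotients — WEAKER than p498282's `hsep`)} — abc-iut-L5-d5's knit (p496337) with `hFcusp :=
hatCuspIncidence_of_conjSeparating` at the datum's completion.  FQ type per the gate rule.
[cite: Mochizuki2012, Cor 2.3(vi) pp.48-49] [claim: Mochizuki2012, status: disputed] -/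
theorem cor23vi_ofSpecialFibre_closureH_of_piData_of_conjSeparating_of_cuspOpenEdgeDict
    (hdict : P.CuspOpenEdgeDict) (i : ℕ) (hTpH : TpH ∈ S.chart.decompSubgroups P.H)
    (hconj : ∀ e : S.Gc.graph.Edge, (∃ b₀ : S.Gc.graph.Branch, S.Gc.graph.edgeOf b₀ = e ∧ S.Gc.graph.abuts b₀ = none) →
      (¬ ∃ b : S.Gc.graph.Branch, S.Gc.graph.edgeOf b = e ∧ ∃ w ∈ P.H.verts, S.Gc.graph.abuts b = some w) →
      ∀ L ∈ edgeLikeSubgroups S.chart e, ∃ U : OpenNormalSubgroup S.chart.G,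
        U.toSubgroup.FiniteIndex ∧ ∀ t : S.chart.G, ¬ L ≤ MulAut.conj t • TpH ⊔ U.toSubgroup) :
    Literature.IUT.HodgeTheaters.StableCurveTemperedData.Cor23vi
        (ofSpecialFibre X d S h36 Sigma SigmaHat hsub hne hprime hp TpH ((TpH.map
          (TemperedGraphGroupData.exists_completion_of_prop36 S.Gc h36 S.chart).choose_spec.choose.toMonoidHom
          ).topologicalClosure) (Subgroup.le_topologicalClosure _)
          (fun x => (P.proj i).vertexMap (P.vtxOfCusp i x) ∈ P.H.verts)) :=
  cor23vi_ofSpecialFibre_closureH_of_piData_of_hatCuspIncidence_of_cuspOpenEdgeDict X d S h36 Sigma SigmaHat hsub hne hprime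
    hp TpH P hdict i hTpH
    (hatCuspIncidence_of_conjSeparating S.chart
      (TemperedGraphGroupData.exists_completion_of_prop36 S.Gc h36 S.chart).choose_spec.choose_spec.1 P.H TpH hconj)

/-- **The same for abc-iut-L5-d5's GROUP-form atom at the record's `Π^tp_ℍ := P.TpH`** ⟸ {`hdict`, `hconj` at `P.TpH`} (via this
lineage's `hatIncidence_verticialOver_of_hatCuspIncidence_of_cuspOpenEdgeDict`, p497321).  FQ type per the gate rule.
[cite: Mochizuki2012, Cor 2.3(vi) pp.48-49] [claim: Mochizuki2012, status: disputed] -/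
theorem cor23vi_ofSpecialFibre_verticialOver_piDataTpH_of_conjSeparating_of_cuspOpenEdgeDict
    (hdict : P.CuspOpenEdgeDict)
    (hconj : ∀ e : S.Gc.graph.Edge, (∃ b₀ : S.Gc.graph.Branch, S.Gc.graph.edgeOf b₀ = e ∧ S.Gc.graph.abuts b₀ = none) →
      (¬ ∃ b : S.Gc.graph.Branch, S.Gc.graph.edgeOf b = e ∧ ∃ w ∈ P.H.verts, S.Gc.graph.abuts b = some w) →
      ∀ L ∈ edgeLikeSubgroups S.chart e, ∃ U : OpenNormalSubgroup S.chart.G,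
        U.toSubgroup.FiniteIndex ∧ ∀ t : S.chart.G, ¬ L ≤ MulAut.conj t • P.TpH ⊔ U.toSubgroup) :
    Literature.IUT.HodgeTheaters.StableCurveTemperedData.Cor23vi
        (ofSpecialFibre X d S h36 Sigma SigmaHat hsub hne hprime hp P.TpH ((P.TpH.map
          (TemperedGraphGroupData.exists_completion_of_prop36 S.Gc h36 S.chart).choose_spec.choose.toMonoidHom
          ).topologicalClosure) (Subgroup.le_topologicalClosure _)
          (fun x => ∃ v ∈ P.H.verts, ∃ K ∈ verticialSubgroups S.chart v,
            ((X.inertia x.1).subgroupOf (X.toTemperedArithmeticGroup d).delta).map S.admissible.toMonoidHom ≤ K)) :=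
  cor23vi_ofSpecialFibre_verticialOver_piDataTpH X d S h36 Sigma SigmaHat hsub hne hprime hp P
    (hatIncidence_verticialOver_of_hatCuspIncidence_of_cuspOpenEdgeDict X d S h36 P.TpH P hdict
      (hatCuspIncidence_of_conjSeparating S.chart
        (TemperedGraphGroupData.exists_completion_of_prop36 S.Gc h36 S.chart).choose_spec.choose_spec.1 P.H P.TpH hconj))

end PiData

end StableCurveTemperedData

end Literature.IUT.HodgeTheaters

end
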